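import Mathlib
import Literature.Probability.LatticeModels.SharpnessProofs
import HarnessLib

/-!
# Stub `stub_susceptibilityLowerOfDirichlet` of line `diffusive-branch-is-nonsaturation` (crux
# `PrecisionLaplacian.DirectCorrelationStableTail`, stmt-CriticalPhenomena-4799): the susceptibility
# lower bound `χ_{2R} ≥ c R²` from the Dirichlet principle

**Statement** (registered text of the lead's skeleton).  Let `G, q : ℤ³ → ℝ` with `G ≥ 0` and `σ ≥ 0`.
Assume the Dirichlet inequality: for every finite `S ⊆ ℤ³`, every `f` and every `h ≥ 0`,
`2 Σ_{x∈S} f(x)h(x) ≤ Σ_{x,y∈S} f(x)f(y)G(y−x) + Σ_{x,y∈S} h(x)h(y)q(y−x)`, and the tent form bound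
`Σ_{x,y∈B_R} h_R(x)h_R(y)q(y−x) ≤ σ R` for the tent `h_R(x) = (1 − ‖x‖_∞/R)₊` on the box
`B_R = {−R,…,R}³`, `R ≥ 1`.  Then there is `c > 0` with `c R² ≤ χ_{2R} := Σ_{w∈B_{2R}} G(w)` for all
`R ≥ 1`.

**Proof.**  Fix `R ≥ 1` and test the Dirichlet inequality with `S = B_R`, `f = 1`, `h = t·h_R`
(`t ≥ 0`): with `P = Σ_{B_R} h_R` this reads `2tP ≤ Σ_{x,y∈B_R} G(y−x) + t²·Σ h_R h_R q`.  For fixed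
`x ∈ B_R` the translate `B_R − x` lies in `B_{2R}` and `G ≥ 0`, so the first term is at most
`(2R+1)³ χ_{2R}`; the second is at most `t² σ R`.  Optimising (`t = P/(σR+1)`) gives
`P² ≤ (σR+1)(2R+1)³ χ_{2R}`.  Finally `P ≥ R³/2`: the sub-box `B_{⌊R/2⌋}` has at least `R³` points, on
each of which `h_R ≥ 1/2`.  With `σR + 1 ≤ (σ+1)R` and `(2R+1)³ ≤ 27R³` this yields
`χ_{2R} ≥ R²/(108(σ+1))`.

Pure theorem file (finite sums on `ℤ³`, Ising-free), no definitions, no `sorry`. [folklore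
(discrete Dirichlet principle / variational susceptibility bound)]
-/

noncomputable section

namespace Summit.CriticalPhenomena.Ising3DConformalLimit.Cruxes.DirectCorrelationStableTail.DiffusiveBranchIsNonsaturation

open scoped BigOperators
open Literature.Probability.LatticeModels

/-! ### Box geometry: translates of `B_R` inside `B_{2R}` -/

/-- For `x ∈ B_R`, the translated sum `Σ_{y∈B_R} G(y − x)` is at most `Σ_{w∈B_{2R}} G(w)` when
`G ≥ 0` (the translate `B_R − x` sits inside `B_{2R}` and `y ↦ y − x` is injective). [folklore] -/
theorem susceptibilityLowerOfDirichlet_sum_shift_le (G : Site 3 → ℝ) (hG : ∀ x, 0 ≤ G x) (R : ℕ)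
    (x : Site 3) (hx : x ∈ box 3 R) :
    ∑ y ∈ box 3 R, G (y - x) ≤ ∑ w ∈ box 3 (2 * R), G w := by
  have e : ∑ y ∈ box 3 R, G (y - x) =
      ∑ w ∈ (box 3 R).map (Equiv.subRight x).toEmbedding, G w := by
    rw [Finset.sum_map]
    simp only [Equiv.coe_toEmbedding, Equiv.subRight_apply]
  rw [e]
  refine Finset.sum_le_sum_of_subset_of_nonneg (fun w hw => ?_) fun w _ _ => hG w
  rw [Finset.mem_map] at hw
  obtain ⟨y, hy, rfl⟩ := hw
  rw [mem_box] at hx hy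
  rw [Equiv.coe_toEmbedding, Equiv.subRight_apply, mem_box]
  intro i
  obtain ⟨hx₁, hx₂⟩ := hx i
  obtain ⟨hy₁, hy₂⟩ := hy i
  rw [Pi.sub_apply]
  push_cast
  omega

/-- `⟨𝟙_{B_R}, G 𝟙_{B_R}⟩ = Σ_{x,y∈B_R} G(y − x) ≤ (2R+1)³ · Σ_{w∈B_{2R}} G(w)` for `G ≥ 0`. [folklore] -/
theorem susceptibilityLowerOfDirichlet_double_sum_le (G : Site 3 → ℝ) (hG : ∀ x, 0 ≤ G x) (R : ℕ) :
    ∑ x ∈ box 3 R, ∑ y ∈ box 3 R, G (y - x) ≤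
      ((2 * R + 1 : ℕ) : ℝ) ^ 3 * ∑ w ∈ box 3 (2 * R), G w := by
  calc ∑ x ∈ box 3 R, ∑ y ∈ box 3 R, G (y - x)
      ≤ ∑ x ∈ box 3 R, ∑ w ∈ box 3 (2 * R), G w :=
        Finset.sum_le_sum fun x hx => susceptibilityLowerOfDirichlet_sum_shift_le G hG R x hx
    _ = ((2 * R + 1 : ℕ) : ℝ) ^ 3 * ∑ w ∈ box 3 (2 * R), G w := by
        rw [Finset.sum_const, nsmul_eq_mul, card_box]
        push_cast
        ring

/-! ### The tent has mass `≥ R³/2` -/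

/-- The tent `h_R(x) = (1 − ‖x‖_∞/R)₊` has `Σ_{x∈B_R} h_R(x) ≥ R³/2` for `R ≥ 1`: it is `≥ 1/2` on the
sub-box `B_{⌊R/2⌋}`, which has `(2⌊R/2⌋+1)³ ≥ R³` points. [folklore] -/
theorem susceptibilityLowerOfDirichlet_tent_mass (R : ℕ) (hR : 1 ≤ R) :
    (R : ℝ) ^ 3 / 2 ≤ ∑ x ∈ box 3 R, max 0 (1 - ‖x‖ / (R : ℝ)) := by
  have hRpos : (0 : ℝ) < R := by exact_mod_cast hR
  have hsub : box 3 (R / 2) ⊆ box 3 R := box_mono 3 (Nat.div_le_self R 2)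
  have hhalf : ∀ x ∈ box 3 (R / 2), (1 / 2 : ℝ) ≤ max 0 (1 - ‖x‖ / (R : ℝ)) := by
    intro x hx
    rw [mem_box_iff_supNorm_le] at hx
    refine le_trans ?_ (le_max_right _ _)
    rw [Site.norm_eq_supNorm]
    have h1 : ((Site.supNorm x : ℕ) : ℝ) ≤ (R : ℝ) / 2 :=
      calc ((Site.supNorm x : ℕ) : ℝ) ≤ ((R / 2 : ℕ) : ℝ) := by exact_mod_cast hx
        _ ≤ (R : ℝ) / 2 := Nat.cast_div_le
    have h2 : ((Site.supNorm x : ℕ) : ℝ) / R ≤ 1 / 2 := by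
      rw [div_le_iff₀ hRpos]
      linarith
    linarith
  have hcard : (R : ℝ) ^ 3 ≤ ((box 3 (R / 2)).card : ℝ) := by
    rw [card_box]
    have h : R ^ 3 ≤ (2 * (R / 2) + 1) ^ 3 := Nat.pow_le_pow_left (by omega) 3
    exact_mod_cast h
  calc (R : ℝ) ^ 3 / 2 ≤ ((box 3 (R / 2)).card : ℝ) * (1 / 2) := by linarith
    _ = ∑ _x ∈ box 3 (R / 2), (1 / 2 : ℝ) := by rw [Finset.sum_const, nsmul_eq_mul]
    _ ≤ ∑ x ∈ box 3 (R / 2), max 0 (1 - ‖x‖ / (R : ℝ)) := Finset.sum_le_sum hhalf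
    _ ≤ ∑ x ∈ box 3 R, max 0 (1 - ‖x‖ / (R : ℝ)) :=
        Finset.sum_le_sum_of_subset_of_nonneg hsub fun x _ _ => le_max_left _ _

/-! ### Testing the Dirichlet inequality with `f = 1`, `h = t φ`, and optimising in `t` -/

/-- Testing the Dirichlet inequality on `S` with `f = 𝟙` and `h = t·φ` (`t ≥ 0`, `φ ≥ 0`):
`2t Σ_S φ ≤ Σ_{x,y∈S} G(y−x) + t² Σ_{x,y∈S} φ(x)φ(y)q(y−x)`. [folklore] -/
theorem susceptibilityLowerOfDirichlet_quadratic (G q : Site 3 → ℝ) (S : Finset (Site 3))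
    (φ : Site 3 → ℝ) (hφ : ∀ x, 0 ≤ φ x)
    (hDir : ∀ (f h : Site 3 → ℝ), (∀ x, 0 ≤ h x) →
      2 * ∑ x ∈ S, f x * h x ≤ (∑ x ∈ S, ∑ y ∈ S, f x * f y * G (y - x)) +
        ∑ x ∈ S, ∑ y ∈ S, h x * h y * q (y - x))
    (t : ℝ) (ht : 0 ≤ t) :
    2 * t * ∑ x ∈ S, φ x ≤
      (∑ x ∈ S, ∑ y ∈ S, G (y - x)) + t ^ 2 * ∑ x ∈ S, ∑ y ∈ S, φ x * φ y * q (y - x) := by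
  have h := hDir (fun _ => 1) (fun x => t * φ x) fun x => mul_nonneg ht (hφ x)
  simp only [one_mul] at h
  have e1 : ∑ x ∈ S, t * φ x = t * ∑ x ∈ S, φ x := (Finset.mul_sum _ _ _).symm
  have e2 : ∑ x ∈ S, ∑ y ∈ S, t * φ x * (t * φ y) * q (y - x) =
      t ^ 2 * ∑ x ∈ S, ∑ y ∈ S, φ x * φ y * q (y - x) := by
    rw [Finset.mul_sum]
    refine Finset.sum_congr rfl fun x _ => ?_
    rw [Finset.mul_sum]
    refine Finset.sum_congr rfl fun y _ => ?_
    ring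
  rw [e1, e2] at h
  linarith

/-- Elementary optimisation: if `2tP ≤ M + t²E` for all `t ≥ 0` (`P, E ≥ 0`), then `P² ≤ (E+1)M`
(take `t = P/(E+1)`). [folklore] -/
theorem susceptibilityLowerOfDirichlet_optimise (P M E : ℝ) (hE : 0 ≤ E) (hP : 0 ≤ P)
    (h : ∀ t : ℝ, 0 ≤ t → 2 * t * P ≤ M + t ^ 2 * E) : P ^ 2 ≤ (E + 1) * M := by
  have hD : 0 < E + 1 := by linarith
  have ht := h (P / (E + 1)) (div_nonneg hP hD.le)
  have e1 : 2 * (P / (E + 1)) * P = 2 * P ^ 2 / (E + 1) := by ring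
  have e2 : (P / (E + 1)) ^ 2 * E = P ^ 2 * E / (E + 1) ^ 2 := by rw [div_pow]; ring
  rw [e1, e2] at ht
  have key : P ^ 2 * E / (E + 1) ^ 2 ≤ P ^ 2 / (E + 1) := by
    rw [div_le_div_iff₀ (by positivity) hD]
    nlinarith [sq_nonneg P, mul_nonneg (sq_nonneg P) hE]
  have h2 : P ^ 2 / (E + 1) ≤ M := by
    have e3 : 2 * P ^ 2 / (E + 1) = 2 * (P ^ 2 / (E + 1)) := by ring
    rw [e3] at ht
    linarith
  rw [div_le_iff₀ hD] at h2
  linarith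

/-! ### The stub -/

/-- **Stub 3 `stub_susceptibilityLowerOfDirichlet` (susceptibility lower bound from the Dirichlet
principle; Ising-free)**, registered text of the lead's skeleton.  If `G ≥ 0` satisfies the Dirichlet
inequality with some precision kernel `q`, and the tent `h_R = (1 − ‖x‖_∞/R)₊` has `q`-form `≤ σ R`,
then `χ_{2R} := Σ_{‖w‖_∞ ≤ 2R} G(w) ≥ c R²` for all `R ≥ 1`, with `c = 1/(108(σ+1))`.
Proof: `f = 𝟙_{B_R}`, `h = t h_R`, `t = P/(σR+1)`, `P = Σ_{B_R} h_R ≥ R³/2`, and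
`⟨f, G f⟩ ≤ (2R+1)³ χ_{2R}`. [folklore (discrete Dirichlet principle)] -/
theorem stub_susceptibilityLowerOfDirichlet :
    ∀ (G q : Site 3 → ℝ) (σ : ℝ), (∀ x, 0 ≤ G x) → 0 ≤ σ →
      (∀ (S : Finset (Site 3)) (f h : Site 3 → ℝ), (∀ x, 0 ≤ h x) →
        2 * ∑ x ∈ S, f x * h x ≤ (∑ x ∈ S, ∑ y ∈ S, f x * f y * G (y - x)) +
          ∑ x ∈ S, ∑ y ∈ S, h x * h y * q (y - x)) →
      (∀ R : ℕ, 1 ≤ R →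
        ∑ x ∈ box 3 R, ∑ y ∈ box 3 R, max 0 (1 - ‖x‖ / (R : ℝ)) * max 0 (1 - ‖y‖ / (R : ℝ)) * q (y - x) ≤
          σ * R) →
      ∃ c : ℝ, 0 < c ∧ ∀ R : ℕ, 1 ≤ R → c * (R : ℝ) ^ 2 ≤ ∑ w ∈ box 3 (2 * R), G w := by
  intro G q σ hG hσ hDir hTent
  refine ⟨1 / (108 * (σ + 1)), by positivity, fun R hR => ?_⟩
  have hR1 : (1 : ℝ) ≤ R := by exact_mod_cast hR
  have hRpos : (0 : ℝ) < R := by linarith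
  -- the susceptibility `χ = χ_{2R}` and the tent mass `P`
  have hχ : 0 ≤ ∑ w ∈ box 3 (2 * R), G w := Finset.sum_nonneg fun w _ => hG w
  have hPge : (R : ℝ) ^ 3 / 2 ≤ ∑ x ∈ box 3 R, max 0 (1 - ‖x‖ / (R : ℝ)) :=
    susceptibilityLowerOfDirichlet_tent_mass R hR
  have hPnn : 0 ≤ ∑ x ∈ box 3 R, max 0 (1 - ‖x‖ / (R : ℝ)) :=
    Finset.sum_nonneg fun x _ => le_max_left _ _
  -- the quadratic inequality `2tP ≤ (2R+1)³ χ + t² σR` for all `t ≥ 0`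
  have hquad : ∀ t : ℝ, 0 ≤ t →
      2 * t * ∑ x ∈ box 3 R, max 0 (1 - ‖x‖ / (R : ℝ)) ≤
        ((2 * R + 1 : ℕ) : ℝ) ^ 3 * (∑ w ∈ box 3 (2 * R), G w) + t ^ 2 * (σ * R) := by
    intro t ht
    have h1 := susceptibilityLowerOfDirichlet_quadratic G q (box 3 R)
      (fun x => max 0 (1 - ‖x‖ / (R : ℝ))) (fun x => le_max_left _ _) (hDir (box 3 R)) t ht
    have h2 := susceptibilityLowerOfDirichlet_double_sum_le G hG R
    have h3 : t ^ 2 * ∑ x ∈ box 3 R, ∑ y ∈ box 3 R,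
        max 0 (1 - ‖x‖ / (R : ℝ)) * max 0 (1 - ‖y‖ / (R : ℝ)) * q (y - x) ≤ t ^ 2 * (σ * R) :=
      mul_le_mul_of_nonneg_left (hTent R hR) (sq_nonneg t)
    linarith
  -- optimise in `t`
  have hopt := susceptibilityLowerOfDirichlet_optimise _ _ _ (by positivity) hPnn hquad
  -- elementary bounds `σR + 1 ≤ (σ+1)R`, `(2R+1)³ ≤ 27R³`
  have hD : σ * R + 1 ≤ (σ + 1) * R := by nlinarith
  have hN : ((2 * R + 1 : ℕ) : ℝ) ^ 3 ≤ 27 * (R : ℝ) ^ 3 := by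
    have h : ((2 * R + 1 : ℕ) : ℝ) ≤ 3 * R := by push_cast; linarith
    calc ((2 * R + 1 : ℕ) : ℝ) ^ 3 ≤ (3 * (R : ℝ)) ^ 3 := pow_le_pow_left₀ (by positivity) h 3
      _ = 27 * (R : ℝ) ^ 3 := by ring
  -- chain: `R⁶/4 ≤ P² ≤ (σR+1)(2R+1)³χ ≤ 27(σ+1)R⁴χ`
  have hlow : (R : ℝ) ^ 6 / 4 ≤ (σ * R + 1) * (((2 * R + 1 : ℕ) : ℝ) ^ 3 * ∑ w ∈ box 3 (2 * R), G w) :=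
    calc (R : ℝ) ^ 6 / 4 = ((R : ℝ) ^ 3 / 2) ^ 2 := by ring
      _ ≤ (∑ x ∈ box 3 R, max 0 (1 - ‖x‖ / (R : ℝ))) ^ 2 := pow_le_pow_left₀ (by positivity) hPge 2
      _ ≤ _ := hopt
  have hup : (σ * R + 1) * (((2 * R + 1 : ℕ) : ℝ) ^ 3 * ∑ w ∈ box 3 (2 * R), G w) ≤
      (σ + 1) * R * (27 * (R : ℝ) ^ 3 * ∑ w ∈ box 3 (2 * R), G w) :=
    mul_le_mul hD (mul_le_mul_of_nonneg_right hN hχ) (by positivity) (by positivity)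
  -- conclude: divide `R⁶ ≤ 108(σ+1)R⁴χ` by `R⁴ > 0`
  rw [div_mul_eq_mul_div, one_mul, div_le_iff₀ (by positivity)]
  have hR4 : (0 : ℝ) < (R : ℝ) ^ 4 := by positivity
  refine le_of_mul_le_mul_left ?_ hR4
  have e1 : (R : ℝ) ^ 4 * (R : ℝ) ^ 2 = (R : ℝ) ^ 6 := by ring
  have e2 : (R : ℝ) ^ 4 * ((∑ w ∈ box 3 (2 * R), G w) * (108 * (σ + 1))) =
      4 * ((σ + 1) * R * (27 * (R : ℝ) ^ 3 * ∑ w ∈ box 3 (2 * R), G w)) := by ring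
  rw [e1, e2]
  linarith

end Summit.CriticalPhenomena.Ising3DConformalLimit.Cruxes.DirectCorrelationStableTail.DiffusiveBranchIsNonsaturation

end
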